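import Mathlib
import Summits.NavierStokesRegularity.OSWSelfSimilar.SheetMomentIdentity
import Summits.NavierStokesRegularity.OSWSelfSimilar.SheetHalfLineMomentNull
import Summits.NavierStokesRegularity.OSWSelfSimilar.SheetHalfLineVelocitySign
import Literature.Analysis.Fourier.HilbertTransformLineSplit
import HarnessLib

/-!
# Viscous gCLM/OSW profile MODEL, NS-type line: the TAIL LAW `c_l·A = a∫₀^∞𝒰Ω` with the genuine Hilbert transform,
# and the census decl «for EVERY `a < 0` the NS-type line carries NO E-signed blow-up profile»

HONEST FRAMING (cell ns-blowup GROUP B «PROFILE SEARCH», zone Z3 = the 1-D viscous gCLM/OSW sheet; human rulings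
D-0035/D-0074): **1-D MODEL; not Euler, not Navier–Stokes; «violates: none — MODEL».** Nothing here is a statement about NS.

This file plugs the two nonlocal inputs — the moment null `∫₀^∞ ξ(HΩ)Ω = 0` (`SheetHalfLineMomentNull`) and the outward
velocity `𝒰 ≥ 0` on `(0,∞)` in Chen's class 3 (`SheetHalfLineVelocitySign`) — into the first-moment identity / tail law /
sign law 3 of `SheetMomentIdentity`, for `H = hilbertTransform Ω` (`𝒰′ = HΩ`, `𝒰(0) = 0`). PROFILE CLASS (all hypotheses are
on `Ω` itself, plus the sheet equation and the decay class of the velocity pairing): `Ω` odd, `C²` (`Ω′ = dOm`, `Ω″ = ddOm`),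
`|Ω′| ≤ M`, envelope `|Ω(ξ)| ≤ C/(1+ξ²)` (the NS-type-line tail class `Ω ~ Aξ⁻²`; it gives `Ω ∈ L¹ ∩ L²`, `ξΩ ∈ L²`, `Ω → 0`),
`F₁(c_ω, c_ω/2, a, b = 1, ε, HΩ, 𝒰, Ω) ≡ 0` on `(0,∞)`, `𝒰Ω, ξ(HΩ)Ω ∈ L¹(0,∞)`, `ξ𝒰(ξ)Ω(ξ) → 0`, `ξΩ′(ξ) → 0`.

WHAT IS KERNEL-CHECKED HERE.
* `nsTypeLine_tail_law` — **THE TAIL LAW with the genuine Hilbert transform** (any `a`, any `ε`, any sign structure):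
  `(c_ω/2)·ξ²Ω(ξ) → a ∫₀^∞ 𝒰Ω` as `ξ → ∞` — the `ξ⁻²` tail amplitude `A` of an NS-type-line profile EXISTS and equals
  `(2a/c_ω)∫₀^∞𝒰Ω`. A new EXACT readout for the cell's E½ branch (`a > 0`; e.g. `A = −21.8178(1)` at `a = 0.2`, SHEET §4.1): the
  tail amplitude is the velocity–vorticity pairing.
* `nsTypeLine_tail_zero_of_a_eq_zero` — at the CLM point `a = 0` every such profile has `ξ²Ω(ξ) → 0`: NO `ξ⁻²` tail on the
  NS-type line at `a = 0` (the exact Schochet corner `−24vξ/(ξ²+v²)²`, `SheetNSLineSchochetCorner`, decays like `ξ⁻³`).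
* `nsTypeLine_tail_neg_of_a_pos` — for `a > 0` a NON-TRIVIAL E-signed profile has a GENUINE algebraic tail:
  `lim (c_ω/2)ξ²Ω = a∫₀^∞𝒰Ω < 0` (so `ξΩ ∉ L¹(0,∞)`: the E½ sign class lives in the `ξ⁻²` tail class and nowhere faster).
* `nsTypeLine_ESigned_empty_of_a_neg` — **THE CENSUS DECL: for EVERY `a < 0` (and every `ε`, every `c_ω > 0`) the NS-type line
  `c_l = c_ω/2` of the gCLM/OSW sheet carries NO E-signed (`Ω ≤ 0` on `(0,∞)`, Chen's class 3 — the sign class of E½ and of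
  every blow-up profile the cell has found) profile in the class above: `Ω ≡ 0`.** Proof = tail law + outward velocity:
  `(c_ω/2)A ≤ 0 ≤ a∫₀^∞𝒰Ω`. This EXTENDS `nsTypeLine_ESigned_empty_of_a_le_neg_one` (`a ≤ −1`, from the half-line identity (★),
  `SheetHalfLineSignLaws`) to the whole range `−1 < a < 0` of CENSUS-Z3 row Z3-E12⁻ clause (i′), where the cell's word so far was
  the SEARCH word «NONE FOUND (c_ω > 0) at a ∈ {−0.1, …, −2} under 168 Newton runs/a, one code — never an exclusion».
  Reading (MODEL, steady side of clause (i′)): on the NS-type line the E-signed blow-up sector is EMPTY for all `a < 0` and the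
  Schochet corner `a = 0` (`A = 0`) is its boundary — «the divide is the corner» is now a KERNEL statement for the E-signed class.
NOT PROVED HERE: anything dynamic (the «arrest» half of clause (i′) stays class (D) numerics, one code); profiles outside the
class (sign-changing `Ω`, slower tails, `𝒰Ω ∉ L¹`); existence of E½; anything about Euler or NS.
bears_on: LADDER-NS N5 / zone Z3 clause (i′) (CENSUS-Z3 v2.9 §0) → N1 linear core; SELFSIM-NOGO M7/M8 MODEL side.
-/

noncomputable section
open Set Filter Topology MeasureTheory
open scoped Real

namespace Summit.NavierStokesRegularity.OSWSelfSimilar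
namespace SheetHalfLine
open HouLuoOriginLaws (F1)
open Literature.Analysis.Fourier

/-! ### The profile class: what the envelope `|Ω| ≤ C/(1+ξ²)` buys -/

/-- `C ≥ 0` from the envelope at `0`. [folklore] -/
theorem env_const_nonneg {Om : ℝ → ℝ} {C : ℝ} (hC : ∀ y, |Om y| ≤ C / (1 + y ^ 2)) : 0 ≤ C := by
  have h := hC 0
  have : |Om 0| ≤ C := by simpa using h
  exact (abs_nonneg _).trans this

/-- Envelope ⇒ `Ω ∈ L¹`. [folklore] -/
theorem integrable_of_env {Om : ℝ → ℝ} {C : ℝ} (hc : Continuous Om) (hC : ∀ y, |Om y| ≤ C / (1 + y ^ 2)) :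
    Integrable Om := by
  refine (integrable_inv_one_add_sq.const_mul C).mono' hc.aestronglyMeasurable (Eventually.of_forall fun y => ?_)
  rw [Real.norm_eq_abs, ← div_eq_mul_inv]
  exact hC y

/-- Envelope ⇒ `Ω ∈ L²`. [folklore] -/
theorem memLp_two_of_env {Om : ℝ → ℝ} {C : ℝ} (hc : Continuous Om) (hC : ∀ y, |Om y| ≤ C / (1 + y ^ 2)) :
    MemLp Om 2 := by
  have hC0 := env_const_nonneg hC
  rw [memLp_two_iff_integrable_sq hc.aestronglyMeasurable]
  refine (integrable_inv_one_add_sq.const_mul (C ^ 2)).mono' (hc.pow 2).aestronglyMeasurable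
    (Eventually.of_forall fun y => ?_)
  rw [Real.norm_eq_abs, abs_of_nonneg (sq_nonneg _)]
  have h1 : 0 < 1 + y ^ 2 := by positivity
  have h := hC y
  have hsq : Om y ^ 2 ≤ (C / (1 + y ^ 2)) ^ 2 := by
    nlinarith [abs_nonneg (Om y), sq_abs (Om y), div_nonneg hC0 h1.le]
  calc Om y ^ 2 ≤ (C / (1 + y ^ 2)) ^ 2 := hsq
    _ = C ^ 2 * (1 + y ^ 2)⁻¹ * (1 + y ^ 2)⁻¹ := by rw [div_eq_mul_inv]; ring
    _ ≤ C ^ 2 * (1 + y ^ 2)⁻¹ * 1 := by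
        apply mul_le_mul_of_nonneg_left _ (by positivity)
        exact inv_le_one_of_one_le₀ (by nlinarith [sq_nonneg y])
    _ = C ^ 2 * (1 + y ^ 2)⁻¹ := by ring

/-- Envelope ⇒ `ξΩ ∈ L²`. [folklore] -/
theorem memLp_two_id_mul_of_env {Om : ℝ → ℝ} {C : ℝ} (hc : Continuous Om) (hC : ∀ y, |Om y| ≤ C / (1 + y ^ 2)) :
    MemLp (fun y => y * Om y) 2 := by
  have hC0 := env_const_nonneg hC
  have hm : Continuous fun y => y * Om y := continuous_id.mul hc
  rw [memLp_two_iff_integrable_sq hm.aestronglyMeasurable]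
  refine (integrable_inv_one_add_sq.const_mul (C ^ 2)).mono' (hm.pow 2).aestronglyMeasurable
    (Eventually.of_forall fun y => ?_)
  rw [Real.norm_eq_abs, abs_of_nonneg (sq_nonneg _)]
  have h1 : 0 < 1 + y ^ 2 := by positivity
  have h := hC y
  have hsq : Om y ^ 2 ≤ (C / (1 + y ^ 2)) ^ 2 := by
    nlinarith [abs_nonneg (Om y), sq_abs (Om y), div_nonneg hC0 h1.le]
  have hy : y ^ 2 * (1 + y ^ 2)⁻¹ ≤ 1 := by
    rw [← div_eq_mul_inv, div_le_one h1]
    linarith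
  calc (y * Om y) ^ 2 = y ^ 2 * Om y ^ 2 := by ring
    _ ≤ y ^ 2 * (C / (1 + y ^ 2)) ^ 2 := mul_le_mul_of_nonneg_left hsq (sq_nonneg y)
    _ = C ^ 2 * (1 + y ^ 2)⁻¹ * (y ^ 2 * (1 + y ^ 2)⁻¹) := by rw [div_eq_mul_inv]; ring
    _ ≤ C ^ 2 * (1 + y ^ 2)⁻¹ * 1 := mul_le_mul_of_nonneg_left hy (by positivity)
    _ = C ^ 2 * (1 + y ^ 2)⁻¹ := by ring

/-- Envelope ⇒ `Ω(ξ) → 0` at `+∞`. [folklore] -/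
theorem tendsto_zero_of_env {Om : ℝ → ℝ} {C : ℝ} (hC : ∀ y, |Om y| ≤ C / (1 + y ^ 2)) :
    Tendsto Om atTop (𝓝 0) := by
  have h1 : Tendsto (fun y : ℝ => 1 + y ^ 2) atTop atTop :=
    tendsto_atTop_add_const_left _ _ (tendsto_pow_atTop two_ne_zero)
  have h2 : Tendsto (fun y : ℝ => C / (1 + y ^ 2)) atTop (𝓝 0) := tendsto_const_nhds.div_atTop h1
  exact squeeze_zero_norm (fun y => by rw [Real.norm_eq_abs]; exact hC y) h2

/-- `C¹` with continuous derivative ⇒ the symmetric p.v. integrand of `Ω ∈ L¹` is integrable at every base point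
(tree: `integrableOn_symmIntegrand_of_contDiff`). [folklore] -/
theorem integrableOn_symmIntegrand_of_hasDerivAt {Om dOm : ℝ → ℝ} (hOm : ∀ ξ, HasDerivAt Om (dOm ξ) ξ)
    (hdOmc : Continuous dOm) (hΩi : Integrable Om) (x : ℝ) :
    IntegrableOn (fun t => (Om (x - t) - Om (x + t)) / t) (Ioi 0) := by
  have hd : deriv Om = dOm := funext fun y => (hOm y).deriv
  have h1 : ContDiff ℝ 1 Om := by
    rw [contDiff_one_iff_deriv]
    exact ⟨fun y => (hOm y).differentiableAt, by rw [hd]; exact hdOmc⟩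
  exact integrableOn_symmIntegrand_of_contDiff h1 hΩi x

/-! ### The tail law on the NS-type line with the genuine Hilbert transform -/

/-- **THE TAIL LAW ON THE NS-TYPE LINE, genuine Hilbert transform.** For an odd `C²` profile with `|Ω′| ≤ M`,
`|Ω(ξ)| ≤ C/(1+ξ²)`, `𝒰′ = HΩ` (`H = hilbertTransform Ω`), solving `F₁(c_ω, c_ω/2, a, 1, ε) ≡ 0` on `(0,∞)`, with
`𝒰Ω, ξ(HΩ)Ω ∈ L¹(0,∞)` and `ξ𝒰(ξ)Ω(ξ) → 0`, `ξΩ′(ξ) → 0`: `(c_ω/2)·ξ²Ω(ξ) → a ∫₀^∞ 𝒰Ω` — the `ξ⁻²` tail amplitude is the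
velocity–vorticity pairing (any `a`, `ε`, sign structure; `𝒰(0)` free). [new here — MODEL] -/
theorem nsTypeLine_tail_law (cω a ε M C : ℝ) (U Om dOm ddOm : ℝ → ℝ) (hodd : ∀ y, Om (-y) = -Om y)
    (hOm : ∀ ξ, HasDerivAt Om (dOm ξ) ξ) (hdOm : ∀ ξ, HasDerivAt dOm (ddOm ξ) ξ)
    (hM : ∀ y, |dOm y| ≤ M) (hC : ∀ y, |Om y| ≤ C / (1 + y ^ 2))
    (hU : ∀ ξ, HasDerivAt U (hilbertTransform Om ξ) ξ)
    (hF : ∀ ξ ∈ Ioi (0:ℝ), F1 cω (cω / 2) a 1 ε (hilbertTransform Om) U Om dOm ddOm (fun _ => 0) ξ = 0)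
    (iUOm : IntegrableOn (fun ξ => U ξ * Om ξ) (Ioi 0))
    (iH : IntegrableOn (fun ξ => ξ * (hilbertTransform Om ξ * Om ξ)) (Ioi 0))
    (hUOm : Tendsto (fun R => R * U R * Om R) atTop (𝓝 0))
    (hdOm1 : Tendsto (fun R => R * dOm R) atTop (𝓝 0)) :
    Tendsto (fun R => cω / 2 * (R ^ 2 * Om R)) atTop (𝓝 (a * ∫ ξ in Ioi (0:ℝ), U ξ * Om ξ)) := by
  have _hM := hM
  have hc : Continuous Om := continuous_iff_continuousAt.mpr fun x => (hOm x).continuousAt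
  have hdOmc : Continuous dOm := continuous_iff_continuousAt.mpr fun x => (hdOm x).continuousAt
  have hΩi := integrable_of_env hc hC
  have hmom := integral_Ioi_id_mul_hilbertTransform_mul_eq_zero hodd hΩi (memLp_two_of_env hc hC)
    (memLp_two_id_mul_of_env hc hC) (integrableOn_symmIntegrand_of_hasDerivAt hOm hdOmc hΩi)
  have hOm0 : Om 0 = 0 := by
    have h := hodd 0
    simp only [neg_zero] at h
    linarith
  have hF' : ∀ ξ ∈ Ioi (0:ℝ), F1 (2 * (cω / 2)) (cω / 2) a 1 ε (hilbertTransform Om) U Om dOm ddOm (fun _ => 0) ξ = 0 :=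
    fun ξ hξ => by rw [show 2 * (cω / 2) = cω by ring]; exact hF ξ hξ
  exact nsLine_tail_law_gCLM (cω / 2) a ε (hilbertTransform Om) U Om dOm ddOm hU hOm hdOm hOm0 hF' iUOm iH hUOm hdOm1
    (tendsto_zero_of_env hC) hmom

/-- **At the CLM point `a = 0`: NO `ξ⁻²` tail on the NS-type line.** In the setting of `nsTypeLine_tail_law` with `a = 0` and
`c_ω ≠ 0`, `ξ²Ω(ξ) → 0` (as for the exact Schochet corner, which decays like `ξ⁻³`). [new here — MODEL] -/
theorem nsTypeLine_tail_zero_of_a_eq_zero (cω ε M C : ℝ) (U Om dOm ddOm : ℝ → ℝ) (hcω : cω ≠ 0)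
    (hodd : ∀ y, Om (-y) = -Om y)
    (hOm : ∀ ξ, HasDerivAt Om (dOm ξ) ξ) (hdOm : ∀ ξ, HasDerivAt dOm (ddOm ξ) ξ)
    (hM : ∀ y, |dOm y| ≤ M) (hC : ∀ y, |Om y| ≤ C / (1 + y ^ 2))
    (hU : ∀ ξ, HasDerivAt U (hilbertTransform Om ξ) ξ)
    (hF : ∀ ξ ∈ Ioi (0:ℝ), F1 cω (cω / 2) 0 1 ε (hilbertTransform Om) U Om dOm ddOm (fun _ => 0) ξ = 0)
    (iUOm : IntegrableOn (fun ξ => U ξ * Om ξ) (Ioi 0))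
    (iH : IntegrableOn (fun ξ => ξ * (hilbertTransform Om ξ * Om ξ)) (Ioi 0))
    (hUOm : Tendsto (fun R => R * U R * Om R) atTop (𝓝 0))
    (hdOm1 : Tendsto (fun R => R * dOm R) atTop (𝓝 0)) :
    Tendsto (fun R => R ^ 2 * Om R) atTop (𝓝 0) := by
  have h := nsTypeLine_tail_law cω 0 ε M C U Om dOm ddOm hodd hOm hdOm hM hC hU hF iUOm iH hUOm hdOm1
  rw [zero_mul] at h
  have h' := h.const_mul (cω / 2)⁻¹
  simp only [mul_zero] at h'
  refine h'.congr' (Eventually.of_forall fun R => ?_)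
  field_simp

/-! ### Sign structure on the NS-type line in Chen's class 3 -/

/-- **For `a > 0` a non-trivial E-signed NS-type-line profile has a GENUINE `ξ⁻²` tail**: in the setting of
`nsTypeLine_tail_law` with `𝒰(0) = 0`, `Ω ≤ 0` on `(0,∞)`, `Ω ≢ 0` and `a > 0`: `(c_ω/2)·ξ²Ω(ξ) → a∫₀^∞𝒰Ω` AND this limit is
`< 0`. (So the E½ sign class lies in the exact `ξ⁻²` tail class: `ξΩ ∉ L¹`.) [new here — MODEL] -/
theorem nsTypeLine_tail_neg_of_a_pos (cω a ε M C : ℝ) (U Om dOm ddOm : ℝ → ℝ) (ha : 0 < a) (hodd : ∀ y, Om (-y) = -Om y)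
    (hOm : ∀ ξ, HasDerivAt Om (dOm ξ) ξ) (hdOm : ∀ ξ, HasDerivAt dOm (ddOm ξ) ξ)
    (hM : ∀ y, |dOm y| ≤ M) (hC : ∀ y, |Om y| ≤ C / (1 + y ^ 2))
    (hU : ∀ ξ, HasDerivAt U (hilbertTransform Om ξ) ξ) (hU0 : U 0 = 0)
    (hF : ∀ ξ ∈ Ioi (0:ℝ), F1 cω (cω / 2) a 1 ε (hilbertTransform Om) U Om dOm ddOm (fun _ => 0) ξ = 0)
    (iUOm : IntegrableOn (fun ξ => U ξ * Om ξ) (Ioi 0))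
    (iH : IntegrableOn (fun ξ => ξ * (hilbertTransform Om ξ * Om ξ)) (Ioi 0))
    (hUOm : Tendsto (fun R => R * U R * Om R) atTop (𝓝 0))
    (hdOm1 : Tendsto (fun R => R * dOm R) atTop (𝓝 0))
    (hsign : ∀ ξ ∈ Ioi (0:ℝ), Om ξ ≤ 0) (hne : Om ≠ 0) :
    Tendsto (fun R => cω / 2 * (R ^ 2 * Om R)) atTop (𝓝 (a * ∫ ξ in Ioi (0:ℝ), U ξ * Om ξ))
      ∧ a * ∫ ξ in Ioi (0:ℝ), U ξ * Om ξ < 0 := by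
  refine ⟨nsTypeLine_tail_law cω a ε M C U Om dOm ddOm hodd hOm hdOm hM hC hU hF iUOm iH hUOm hdOm1, ?_⟩
  have hc : Continuous Om := continuous_iff_continuousAt.mpr fun x => (hOm x).continuousAt
  have hdOmc : Continuous dOm := continuous_iff_continuousAt.mpr fun x => (hdOm x).continuousAt
  have cU : Continuous U := continuous_iff_continuousAt.mpr fun x => (hU x).continuousAt
  have hUnn : ∀ ξ ∈ Ioi (0:ℝ), 0 ≤ U ξ :=
    fun ξ hξ => velocity_nonneg hodd hOm hdOmc hM hC hU hU0 hsign (le_of_lt hξ)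
  have hJ : ∫ ξ in Ioi (0:ℝ), U ξ * Om ξ ≤ 0 :=
    setIntegral_nonpos measurableSet_Ioi fun ξ hξ => mul_nonpos_of_nonneg_of_nonpos (hUnn ξ hξ) (hsign ξ hξ)
  rcases lt_or_eq_of_le hJ with hlt | heq
  · exact mul_neg_of_pos_of_neg ha hlt
  · -- ∫₀^∞ 𝒰Ω = 0 forces Ω ≡ 0: contradiction
    exfalso
    have hcon : ContinuousOn (fun ξ => U ξ * Om ξ) (Ioi 0) := (cU.mul hc).continuousOn
    have hz := eqOn_zero_of_nonpos_of_integral_eq_zero hcon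
      (fun ξ hξ => mul_nonpos_of_nonneg_of_nonpos (hUnn ξ hξ) (hsign ξ hξ)) iUOm heq
    have hIoi : EqOn Om 0 (Ioi 0) := by
      intro ξ hξ
      have h := hz hξ
      simp only [Pi.zero_apply, mul_eq_zero] at h
      rcases h with hU0' | hO0
      · exact eq_zero_of_velocity_eq_zero hodd hOm hdOmc hM hC hU hU0 hsign hξ hU0'
      · exact hO0
    exact hne (eq_zero_of_odd_of_eqOn_Ioi hodd hIoi)

/-- **THE CENSUS DECL: for EVERY `a < 0` the NS-type line carries NO E-signed profile.** On the NS-type line `c_l = c_ω/2` of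
the gCLM/OSW sheet (`Literature.Analysis.FluidPDE.effectiveViscosity_half`; blow-up `c_ω > 0`, ANY gauge, ANY `ε`), for every
`a < 0`: an odd `C²` profile `Ω` with `|Ω′| ≤ M`, `|Ω(ξ)| ≤ C/(1+ξ²)`, MODEL velocity `𝒰` (`𝒰′ = HΩ` with the genuine Hilbert
transform, `𝒰(0) = 0`), solving `F₁ ≡ 0` on `(0,∞)`, in the decay class «`𝒰Ω, ξ(HΩ)Ω ∈ L¹(0,∞)`, `ξ𝒰Ω → 0`, `ξΩ′ → 0`», and
E-SIGNED (`Ω ≤ 0` on `(0,∞)`), is `≡ 0`. Proof: `(c_ω/2)·lim ξ²Ω = a∫₀^∞𝒰Ω` (tail law); the left side is `≤ 0` (sign of `Ω`),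
the right side is `≥ 0` (`a < 0` and OUTWARD velocity `𝒰 ≥ 0`), so `∫₀^∞𝒰Ω = 0`, `𝒰Ω ≡ 0`, `Ω ≡ 0` (strictness of the
velocity law). Extends `nsTypeLine_ESigned_empty_of_a_le_neg_one` (`a ≤ −1`) to all `a < 0` — the kernel companion, for the
E-signed class, of CENSUS-Z3 row Z3-E12⁻ clause (i′) «−1 < a < 0: NONE FOUND». [new here — MODEL] -/
theorem nsTypeLine_ESigned_empty_of_a_neg (cω a ε M C : ℝ) (U Om dOm ddOm : ℝ → ℝ) (hcω : 0 < cω) (ha : a < 0)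
    (hodd : ∀ y, Om (-y) = -Om y)
    (hOm : ∀ ξ, HasDerivAt Om (dOm ξ) ξ) (hdOm : ∀ ξ, HasDerivAt dOm (ddOm ξ) ξ)
    (hM : ∀ y, |dOm y| ≤ M) (hC : ∀ y, |Om y| ≤ C / (1 + y ^ 2))
    (hU : ∀ ξ, HasDerivAt U (hilbertTransform Om ξ) ξ) (hU0 : U 0 = 0)
    (hF : ∀ ξ ∈ Ioi (0:ℝ), F1 cω (cω / 2) a 1 ε (hilbertTransform Om) U Om dOm ddOm (fun _ => 0) ξ = 0)
    (iUOm : IntegrableOn (fun ξ => U ξ * Om ξ) (Ioi 0))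
    (iH : IntegrableOn (fun ξ => ξ * (hilbertTransform Om ξ * Om ξ)) (Ioi 0))
    (hUOm : Tendsto (fun R => R * U R * Om R) atTop (𝓝 0))
    (hdOm1 : Tendsto (fun R => R * dOm R) atTop (𝓝 0))
    (hsign : ∀ ξ ∈ Ioi (0:ℝ), Om ξ ≤ 0) : Om = 0 := by
  have hc : Continuous Om := continuous_iff_continuousAt.mpr fun x => (hOm x).continuousAt
  have hdOmc : Continuous dOm := continuous_iff_continuousAt.mpr fun x => (hdOm x).continuousAt
  have hΩi := integrable_of_env hc hC
  have hmom := integral_Ioi_id_mul_hilbertTransform_mul_eq_zero hodd hΩi (memLp_two_of_env hc hC)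
    (memLp_two_id_mul_of_env hc hC) (integrableOn_symmIntegrand_of_hasDerivAt hOm hdOmc hΩi)
  have hOm0 : Om 0 = 0 := by
    have h := hodd 0
    simp only [neg_zero] at h
    linarith
  have hF' : ∀ ξ ∈ Ioi (0:ℝ), F1 (2 * (cω / 2)) (cω / 2) a 1 ε (hilbertTransform Om) U Om dOm ddOm (fun _ => 0) ξ = 0 :=
    fun ξ hξ => by rw [show 2 * (cω / 2) = cω by ring]; exact hF ξ hξ
  have hUnn : ∀ ξ ∈ Ioi (0:ℝ), 0 ≤ U ξ :=
    fun ξ hξ => velocity_nonneg hodd hOm hdOmc hM hC hU hU0 hsign (le_of_lt hξ)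
  have hUstrict : ∀ ξ ∈ Ioi (0:ℝ), U ξ = 0 → Om ξ = 0 :=
    fun ξ hξ hUz => eq_zero_of_velocity_eq_zero hodd hOm hdOmc hM hC hU hU0 hsign hξ hUz
  have hIoi := nsLine_trivial_of_nonpos_of_a_neg (cω / 2) a ε (hilbertTransform Om) U Om dOm ddOm (by linarith) ha
    hU hOm hdOm hOm0 hF' iUOm iH hUOm hdOm1 (tendsto_zero_of_env hC) hmom hsign hUnn hUstrict
  exact eq_zero_of_odd_of_eqOn_Ioi hodd hIoi

end SheetHalfLine
end Summit.NavierStokesRegularity.OSWSelfSimilar
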